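import Summits.Ventures.GridStability.Lyapunov.SublevelTrapping
import Mathlib.Analysis.Calculus.Deriv.Prod
import HarnessLib

/-!
# Soundness of Lyapunov sublevel certificates: from the certified inequalities to invariance and
# attraction FOR THE MODEL (sub-rung G1.<system>-roa)

Venture GRIDFUSION, `plan/PARTITION.md` §0 row `Lyapunov/`, A2 (G1-alg / G1-roa), A5 (this file =
the BRIDGE), A6 (arc exclusion); seat gridfusion-lyap-1; namespace
`Summit.Ventures.GridStability.Lyapunov`.

THREE COLUMNS. CERTIFIED (elsewhere, per Bench file): polynomial inequalities on a semialgebraic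
set, re-derived in the kernel — typically `ε Σ zᵢ² ≤ V` on `{h = 0}` and
`V̇ := ∇V·f ≤ -W` on `{h = 0} ∩ {g ≥ 0} ∩ {V ≤ c}` with `W ≥ 0`, `W > 0` off the equilibrium.
MODELLED: the conclusion of THIS file's theorems is about the ODE `x' = F x` (model `M′` of the
Bench file: classical swing recast, etc.), for every solution in Mathlib's sense; nothing here says
a grid or a machine is stable. VALIDATED: nothing.

WHAT THE BRIDGE NEEDS FROM A BENCH FILE (hypotheses of `certificate_invariance_tendsto`), all of
them algebra or one-variable calculus: (1) `S := {y ∈ M ∩ D | V y ≤ c}` compact —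
`isCompact_sublevel_of_norm_le` + `pi_norm_le_of_sum_sq_le` from the certified lower bound;
(2) fencing `S ⊆ interior D` — `subset_interior_of_forall_pos` from strict domain inequalities on
`S` (the arc-exclusion conjunct `κ ≤ κ_max < 2` of A6; `D = univ` when the dissipation inequality
is certified with the `(c - V)` multiplier only: `certificate_invariance_tendsto_univ`);
(3) the dissipation inequality `LV ≤ -W` on `S`, `W ≥ 0` on `S`, `W > 0` on `S ∩ {V = c}` and
`W = 0` only at `x₀` on `S` — the certified identities plus `V x₀ < c`; (4) along the solution,
`HasDerivWithinAt (V ∘ x) (LV (x t)) (Ici t) t` — the chain rule with the coordinate derivatives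
(`Models.SMIB.hasDerivWithinAt_embed`, `hasDerivWithinAt_of_coord`), `LV` being the emitted `vdot`
polynomial; (5) `x t ∈ M` — the recast constraint holds identically on the embedding
(`Models.SMIB.hcon_eval_embed`). OUTPUT: `x t ∈ S` for all `t ≥ 0` and `x t → x₀`
(resp. `infDist (x t) {W = 0} → 0`): the ROA inclusion `S ⊆ ROA(x₀)` in a-priori form (every
solution; existence of the global solution is `Literature.Analysis.ODE.exists_global_solution_of_sublevel`).

The analysis is `SublevelTrapping.lean` (continuous induction, H-strict trapping, decay of the
dissipation rate); the open-set form and global existence are lit-6's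
`Literature/Analysis/ODE/LyapunovSublevelInvariance.lean`. No definitions here.
-/

noncomputable section

open Set Filter Metric Topology

namespace Summit.Ventures.GridStability.Lyapunov

/-! ### The certificate theorem, general normed phase space -/

section General

variable {E : Type*} [NormedAddCommGroup E] [NormedSpace ℝ E]

/-- **Soundness of a Lyapunov sublevel certificate (invariance + attraction to the zero set of the
dissipation rate).** Phase space a real normed space `E`; `M` a constraint set the solution is
known to stay in (the recast manifold `{h = 0}`, or `univ`), `D` the certified domain
(`{g ≥ 0}`, or `univ`), `S := {y ∈ M ∩ D | V y ≤ c}` the certified piece. Hypotheses: `S` compact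
and inside the interior of `D` (fencing: the level set does not touch `∂D`; vacuous for
`D = univ`); `F`, `V`, `W` continuous on `S`; the CERTIFIED inequalities `LV ≤ -W` and `W ≥ 0` on
`S` and `W > 0` on `S ∩ {V = c}`; a solution `x` of `x' = F x` on `[0, ∞)` (continuous, right
derivative `F (x t)`), along which `V ∘ x` has right derivative `LV (x t)` (chain rule: `LV` is
the polynomial `∇V · F` of the certificate), with `x t ∈ M` for all `t ≥ 0` and `x 0 ∈ S`.
Conclusion: `x t ∈ S` for all `t ≥ 0`, and the distance from `x t` to
`{y ∈ S | W y = 0}` (⊆ the equilibrium set when `W > 0` off equilibria) tends to `0`.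
MODELLED: a statement about the ODE `x' = F x` only. [folklore] -/
theorem certificate_invariance_attraction {F : E → E} {V LV W : E → ℝ} {M D : Set E} {c : ℝ}
    {x : ℝ → E} (hS : IsCompact {y ∈ M ∩ D | V y ≤ c})
    (hSD : {y ∈ M ∩ D | V y ≤ c} ⊆ interior D)
    (hF : ContinuousOn F {y ∈ M ∩ D | V y ≤ c}) (hVc : ContinuousOn V {y ∈ M ∩ D | V y ≤ c})
    (hW : ContinuousOn W {y ∈ M ∩ D | V y ≤ c})
    (hLie : ∀ y ∈ M ∩ D, V y ≤ c → LV y ≤ -W y) (hW0 : ∀ y ∈ M ∩ D, V y ≤ c → 0 ≤ W y)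
    (hWc : ∀ y ∈ M ∩ D, V y = c → 0 < W y)
    (hx : ContinuousOn x (Ici 0)) (hxF : ∀ t, 0 ≤ t → HasDerivWithinAt x (F (x t)) (Ici t) t)
    (hφ : ∀ t, 0 ≤ t → HasDerivWithinAt (V ∘ x) (LV (x t)) (Ici t) t)
    (hxM : ∀ t, 0 ≤ t → x t ∈ M) (h0D : x 0 ∈ D) (h0c : V (x 0) ≤ c) :
    (∀ t, 0 ≤ t → x t ∈ D ∧ V (x t) ≤ c) ∧
      Tendsto (fun t ↦ infDist (x t) {y ∈ M ∩ D | V y ≤ c ∧ W y = 0}) atTop (𝓝 0) := by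
  have hinv : ∀ t, 0 ≤ t → x t ∈ D ∧ V (x t) ≤ c := by
    intro T hT
    have hxT : ContinuousOn x (Icc 0 T) := hx.mono fun s hs ↦ hs.1
    have h := forall_mem_sublevel_of_deriv_neg (D := M ∩ D) (V := V) (c := c) (a := 0) (b := T)
      hS.isClosed hxT ⟨hxM 0 le_rfl, h0D⟩ h0c
      (fun t ht htD htV ↦ eventually_mem_inter_of_forall_mem_of_subset_interior
        (S := {y ∈ M ∩ D | V y ≤ c}) (fun s hs ↦ hxM s hs.1) hSD hxT ht ⟨htD, htV⟩)
      (fun t ht htD htV ↦ ⟨LV (x t), hφ t ht.1, fun heq ↦ by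
        linarith [hLie _ htD htV, hWc _ htD heq]⟩)
      T ⟨hT, le_rfl⟩
    exact ⟨h.1.2, h.2⟩
  refine ⟨hinv, ?_⟩
  have hxS : ∀ t, 0 ≤ t → x t ∈ {y ∈ M ∩ D | V y ≤ c} := fun t ht ↦
    ⟨⟨hxM t ht, (hinv t ht).1⟩, (hinv t ht).2⟩
  have h := tendsto_infDist_dissipation_zero (K := {y ∈ M ∩ D | V y ≤ c}) hS hF hVc hW
    (fun y hy ↦ hW0 y hy.1 hy.2) (fun y hy ↦ hLie y hy.1 hy.2) hx hxF hφ hxS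
  have hZ : {y ∈ {y ∈ M ∩ D | V y ≤ c} | W y = 0} = {y ∈ M ∩ D | V y ≤ c ∧ W y = 0} := by
    ext y; simp only [mem_setOf_eq, and_assoc]
  rwa [hZ] at h

/-- **Soundness of a Lyapunov sublevel certificate (invariance + convergence to the
equilibrium).** As `certificate_invariance_attraction`, plus: `x₀ ∈ S` is the only zero of `W`
on `S` (a certificate `W = ε·(positive definite form)` together with the typed fact that `x₀` is
the only equilibrium in `S` — the arc-exclusion conjunct of the domain, PARTITION A6). Conclusion:
`x t ∈ S` for all `t ≥ 0` and `x t → x₀`. MODELLED: a statement about the ODE `x' = F x` only.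
[folklore] -/
theorem certificate_invariance_tendsto {F : E → E} {V LV W : E → ℝ} {M D : Set E} {c : ℝ}
    {x : ℝ → E} {x₀ : E} (hS : IsCompact {y ∈ M ∩ D | V y ≤ c})
    (hSD : {y ∈ M ∩ D | V y ≤ c} ⊆ interior D)
    (hF : ContinuousOn F {y ∈ M ∩ D | V y ≤ c}) (hVc : ContinuousOn V {y ∈ M ∩ D | V y ≤ c})
    (hW : ContinuousOn W {y ∈ M ∩ D | V y ≤ c})
    (hLie : ∀ y ∈ M ∩ D, V y ≤ c → LV y ≤ -W y) (hW0 : ∀ y ∈ M ∩ D, V y ≤ c → 0 ≤ W y)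
    (hWc : ∀ y ∈ M ∩ D, V y = c → 0 < W y)
    (hx₀ : x₀ ∈ M ∩ D) (hx₀c : V x₀ ≤ c) (hWx₀ : W x₀ = 0)
    (hZ : ∀ y ∈ M ∩ D, V y ≤ c → W y = 0 → y = x₀)
    (hx : ContinuousOn x (Ici 0)) (hxF : ∀ t, 0 ≤ t → HasDerivWithinAt x (F (x t)) (Ici t) t)
    (hφ : ∀ t, 0 ≤ t → HasDerivWithinAt (V ∘ x) (LV (x t)) (Ici t) t)
    (hxM : ∀ t, 0 ≤ t → x t ∈ M) (h0D : x 0 ∈ D) (h0c : V (x 0) ≤ c) :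
    (∀ t, 0 ≤ t → x t ∈ D ∧ V (x t) ≤ c) ∧ Tendsto x atTop (𝓝 x₀) := by
  have hinv := (certificate_invariance_attraction hS hSD hF hVc hW hLie hW0 hWc hx hxF hφ hxM
    h0D h0c).1
  refine ⟨hinv, tendsto_of_dissipation (K := {y ∈ M ∩ D | V y ≤ c}) hS hF hVc hW
    (fun y hy ↦ hW0 y hy.1 hy.2) (fun y hy ↦ hLie y hy.1 hy.2) ⟨hx₀, hx₀c⟩
    (fun y hy ↦ hZ y hy.1 hy.2) hWx₀ hx hxF hφ fun t ht ↦ ⟨⟨hxM t ht, (hinv t ht).1⟩, (hinv t ht).2⟩⟩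

/-- **No-domain form** (`D = univ`: the dissipation inequality is certified on all of
`M ∩ {V ≤ c}`, e.g. with the S-procedure multiplier on `c - V` only): `S := {y ∈ M | V y ≤ c}`
compact, the inequalities on `S`, `W > 0` on `S ∩ {V = c}` ⇒ invariance of `S` along every
solution in `M` starting in `S`, and convergence to `x₀`, the unique zero of `W` on `S`.
[folklore] -/
theorem certificate_invariance_tendsto_univ {F : E → E} {V LV W : E → ℝ} {M : Set E} {c : ℝ}
    {x : ℝ → E} {x₀ : E} (hS : IsCompact {y ∈ M | V y ≤ c})
    (hF : ContinuousOn F {y ∈ M | V y ≤ c}) (hVc : ContinuousOn V {y ∈ M | V y ≤ c})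
    (hW : ContinuousOn W {y ∈ M | V y ≤ c})
    (hLie : ∀ y ∈ M, V y ≤ c → LV y ≤ -W y) (hW0 : ∀ y ∈ M, V y ≤ c → 0 ≤ W y)
    (hWc : ∀ y ∈ M, V y = c → 0 < W y)
    (hx₀ : x₀ ∈ M) (hx₀c : V x₀ ≤ c) (hWx₀ : W x₀ = 0)
    (hZ : ∀ y ∈ M, V y ≤ c → W y = 0 → y = x₀)
    (hx : ContinuousOn x (Ici 0)) (hxF : ∀ t, 0 ≤ t → HasDerivWithinAt x (F (x t)) (Ici t) t)
    (hφ : ∀ t, 0 ≤ t → HasDerivWithinAt (V ∘ x) (LV (x t)) (Ici t) t)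
    (hxM : ∀ t, 0 ≤ t → x t ∈ M) (h0c : V (x 0) ≤ c) :
    (∀ t, 0 ≤ t → V (x t) ≤ c) ∧ Tendsto x atTop (𝓝 x₀) := by
  have hMD : M ∩ (univ : Set E) = M := inter_univ M
  have hS' : IsCompact {y ∈ M ∩ (univ : Set E) | V y ≤ c} := by rwa [hMD]
  have h := certificate_invariance_tendsto (D := univ) (x₀ := x₀) hS' (by simp)
    (by rwa [hMD]) (by rwa [hMD]) (by rwa [hMD])
    (fun y hy ↦ hLie y (by simpa using hy)) (fun y hy ↦ hW0 y (by simpa using hy))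
    (fun y hy ↦ hWc y (by simpa using hy)) (by simpa using hx₀) hx₀c hWx₀
    (fun y hy ↦ hZ y (by simpa using hy)) hx hxF hφ hxM (mem_univ _) h0c
  exact ⟨fun t ht ↦ (h.1 t ht).2, h.2⟩

end General

/-! ### Finite-dimensional helpers: compactness and fencing from certificate-type inequalities -/

section Helpers

/-- **Compactness of the certified piece** in a proper (e.g. finite-dimensional) space: `M`, `D`
closed, `V` continuous on `M ∩ D`, and a norm bound on the piece (from the certified lower bound
`ε‖y‖² ≤ V y ≤ c`, say) give `S = {y ∈ M ∩ D | V y ≤ c}` compact. [folklore] -/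
theorem isCompact_sublevel_of_norm_le {E : Type*} [NormedAddCommGroup E] [ProperSpace E]
    {M D : Set E} {V : E → ℝ} {c R : ℝ}
    (hM : IsClosed M) (hD : IsClosed D) (hV : ContinuousOn V (M ∩ D))
    (hR : ∀ y ∈ M ∩ D, V y ≤ c → ‖y‖ ≤ R) : IsCompact {y ∈ M ∩ D | V y ≤ c} := by
  have hcl : IsClosed {y ∈ M ∩ D | V y ≤ c} :=
    hV.preimage_isClosed_of_isClosed (hM.inter hD) isClosed_Iic
  refine Metric.isCompact_of_isClosed_isBounded hcl ?_
  refine (Metric.isBounded_closedBall (x := (0 : E)) (r := R)).subset fun y hy ↦ ?_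
  rw [mem_closedBall, dist_zero_right]
  exact hR y hy.1 hy.2

/-- **Fencing from strict domain inequalities**: if the domain is `D = {y | ∀ i, 0 ≤ g i y}` with
finitely many continuous `g i`, and the certified piece `S` satisfies `g i > 0` on `S` (e.g. the
arc-exclusion conjunct `κ_max - κ > 0` follows on `{V ≤ c}` from the certified lower bound on `V`),
then `S ⊆ interior D`. [folklore] -/
theorem subset_interior_of_forall_pos {X ι : Type*} [TopologicalSpace X] [Finite ι]
    {g : ι → X → ℝ} (hg : ∀ i, Continuous (g i)) {S : Set X} (hpos : ∀ y ∈ S, ∀ i, 0 < g i y) :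
    S ⊆ interior {y | ∀ i, 0 ≤ g i y} := by
  have hU : IsOpen {y : X | ∀ i, 0 < g i y} := by
    rw [show {y : X | ∀ i, 0 < g i y} = ⋂ i, {y | 0 < g i y} by ext; simp]
    exact isOpen_iInter_of_finite fun i ↦ isOpen_lt continuous_const (hg i)
  have hsub : {y : X | ∀ i, 0 < g i y} ⊆ {y | ∀ i, 0 ≤ g i y} := fun z hz i ↦ (hz i).le
  exact fun y hy ↦ interior_maximal hsub hU (hpos y hy)

/-- **Norm bound from a sum-of-squares bound** on `Fin n → ℝ` (sup norm): `Σ i, (y i)² ≤ R²`,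
`0 ≤ R` ⇒ `‖y‖ ≤ R` — the passage from a certified `ε Σ zᵢ² ≤ V ≤ c` to the norm bound of
`isCompact_sublevel_of_norm_le` with `R² = c/ε`. [folklore] -/
theorem pi_norm_le_of_sum_sq_le {n : ℕ} {y : Fin n → ℝ} {R : ℝ} (hR : 0 ≤ R)
    (h : ∑ i, y i ^ 2 ≤ R ^ 2) : ‖y‖ ≤ R := by
  refine (pi_norm_le_iff_of_nonneg hR).2 fun i ↦ ?_
  rw [Real.norm_eq_abs]
  have hi : y i ^ 2 ≤ R ^ 2 :=
    (Finset.single_le_sum (fun j _ ↦ sq_nonneg (y j)) (Finset.mem_univ i)).trans h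
  exact abs_le_of_sq_le_sq' hi hR |> fun h' ↦ abs_le.2 h'

/-- **Vector solution from coordinate solutions** on `Fin n → ℝ`: the coordinatewise chain-rule
facts (as produced for the recast variables by `Models.SMIB.hasDerivWithinAt_embed`) assemble to
the vector-valued derivative used by the certificate theorems. [folklore] -/
theorem hasDerivWithinAt_of_coord {n : ℕ} {x : ℝ → Fin n → ℝ} {v : Fin n → ℝ} {s : Set ℝ}
    {t : ℝ} (h : ∀ i, HasDerivWithinAt (fun τ ↦ x τ i) (v i) s t) : HasDerivWithinAt x v s t :=
  hasDerivWithinAt_pi.2 h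

end Helpers

end Summit.Ventures.GridStability.Lyapunov

end
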